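import Summits.CriticalPhenomena.PercolationContinuityZ3.Theorems.PercNearOneGluingAdditiveGluingEngineFull
import Summits.CriticalPhenomena.PercolationContinuityZ3.Theorems.PercNearOneGluingAdditiveGluingPeelPairGamma
import HarnessLib

/-! # Crux `PercNearOneGluing.AdditiveGluing` (stmt-CriticalPhenomena-4576), line `peel`, stub `stub_bystanderDesignated_c5` —
# the bystander σ-identity D (law of total probability over the open star of the bystander, glued designation)

Support file (`--supports stmt-CriticalPhenomena-4576`); no definitions, no named facts.

`μ_u = prodBernoulli u` (bond percolation on `Fin n`), a block `T`, a bystander `x ∉ T`, a relay `d ≠ x` and a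
target `b ≠ x`.  The reliability of `d` when the block `insert x T` is glued, written un-glued as
`μ_u(d ↔ b) + μ_u(d ↮ b, d ↔ insert x T, insert x T ↔ b)` (`blockGrowth_glue_real_openConn`), is partitioned by
the set `B` of open neighbours of `x` (the layer event `L_B = {ω | ∀ y, y ∈ B ↔ (y ∉ {x} ∧ ∃ o ∈ {x}, s(o, y) ∈ ω)}`
of `stub_sigmaLaw` with `O = {x}`):
`= Σ_B μ_u(L_B) · [μ_{q_B}(d ↔ b) + μ_{q_B}(d ↮ b, d ↔ T ∪ B, T ∪ B ↔ b)]`, where `q_B` is `u` with the star of `x`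
killed and the pairs inside `B` glued.

Proof.  (0) Each bracket is the probability of ONE event, the preimage `{ω | ω ∪ D_S ∈ d ↔ b}` of the two-point
event under gluing the block (`D_S` = non-loop pairs inside `S`; `blockGrowth_glue_preimage_openConn` and a disjoint
union, `bystD_split`).  (1) Partition by the layer (`sigmaRec_partition u {x}`).  (2) Geometry (`bystD_geo`): on `L_B`,
`ω ∪ D_{insert x T} ∈ d ↔ b` iff `Ψ_B ω ∪ D_{T ∪ B} ∈ d ↔ b`, by `stub_glueReach` on both sides and
`stub_sigmaGeometry` with `O = {x}` (`x ↔ z` in `ω` iff `B ↔ z` in `Ψ_B ω`; `v ↔ z` in `ω` iff in `Ψ_B ω` for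
`v, z ≠ x`).  (3) Law: `stub_sigmaLaw` with `O = {x}`, after `u/{x} = u` (`peelGlue_glue_singleton`).
[cite: KozmaNitzan2024, §3.1 Remark p. 5 (gluing), §3.2 pp. 13–14 (the `σ_B`-decomposition)]
-/

namespace Summit.CriticalPhenomena.PercolationContinuityZ3.Theorems

open MeasureTheory Set
open Literature.Probability.LatticeModels (prodBernoulli)
open Literature.Probability.Percolation (BondConfig openConn openConnIn openGraph openCluster)
open scoped BigOperators Classical

noncomputable section

section BystanderDesignated

variable {n : ℕ}

/-- **The two un-glued summands are ONE event probability**: for every weighting `p`, block `S` and vertices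
`d, b`, `μ_p(d ↔ b) + μ_p(d ↮ b, d ↔ S, S ↔ b) = μ_p{ω | ω ∪ D_S ∈ d ↔ b}` (`D_S` = non-loop pairs inside `S`).
[cite: KozmaNitzan2024, §3.1 Remark p. 5 (gluing)] -/
theorem bystD_split (p : Sym2 (Fin n) → unitInterval) (S : Finset (Fin n)) (d b : Fin n) :
    (prodBernoulli p).real (openConn d b)
        + (prodBernoulli p).real ((openConn d b)ᶜ ∩ (⋃ v ∈ S, openConn d v) ∩ (⋃ v ∈ S, openConn v b)) =
      (prodBernoulli p).real
        {ω : BondConfig (Fin n) | (ω ∪ {e | (∀ z ∈ e, z ∈ S) ∧ ¬ e.IsDiag}) ∈ openConn d b} := by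
  rw [blockGrowth_glue_preimage_openConn S d b]
  have hsplit : (openConn d b ∪ ((⋃ v ∈ S, openConn d v) ∩ (⋃ v ∈ S, openConn v b)) :
      Set (BondConfig (Fin n))) =
      openConn d b ∪ ((openConn d b)ᶜ ∩ (⋃ v ∈ S, openConn d v) ∩ (⋃ v ∈ S, openConn v b)) := by
    ext ω
    simp only [Set.mem_union, Set.mem_inter_iff, Set.mem_compl_iff]
    tauto
  rw [hsplit]
  exact (measureReal_union (Set.disjoint_left.2 fun ω hω hω' => hω'.1.1 hω) MeasurableSet.of_discrete
    (measure_ne_top _ _) (measure_ne_top _ _)).symm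

/-- **Pointwise geometry of the bystander layer, block reach.**  If `B` is exactly the set of open neighbours of `x`
in `ω` (`x ∉ T`), then for every `z ≠ x`: some vertex of `insert x T` reaches `z` in `ω` iff some vertex of `T ∪ B`
reaches `z` in the glued off-star configuration `Ψ_B ω = {e ∈ ω | x ∉ e} ∪ {non-loop pairs inside B}`
(`stub_sigmaGeometry` with `O = {x}`). [cite: KozmaNitzan2024, §3.2 p. 14] -/
theorem bystD_reach_iff (T B : Finset (Fin n)) (x z : Fin n) (ω : BondConfig (Fin n)) (hxT : x ∉ T)
    (hz : z ≠ x)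
    (hL : ∀ y : Fin n, y ∈ B ↔ (y ∉ ({x} : Finset (Fin n)) ∧ ∃ o ∈ ({x} : Finset (Fin n)), s(o, y) ∈ ω)) :
    (∃ s ∈ insert x T, ω ∈ openConn s z) ↔
      ∃ s ∈ T ∪ B, ({e | e ∈ ω ∧ ∀ y ∈ e, y ∉ ({x} : Finset (Fin n))} ∪
        {e | (∀ y ∈ e, y ∈ B) ∧ ¬ e.IsDiag} : BondConfig (Fin n)) ∈ openConn s z := by
  have hclique : ∀ o₁ ∈ ({x} : Finset (Fin n)), ∀ o₂ ∈ ({x} : Finset (Fin n)), o₁ ≠ o₂ → s(o₁, o₂) ∈ ω :=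
    fun o₁ h₁ o₂ h₂ hne => absurd ((Finset.mem_singleton.1 h₁).trans (Finset.mem_singleton.1 h₂).symm) hne
  obtain ⟨h1, h2⟩ := stub_sigmaGeometry n ({x} : Finset (Fin n)) B ω hL hclique
  have hzx : z ∉ ({x} : Finset (Fin n)) := fun h => hz (Finset.mem_singleton.1 h)
  have hTx : ∀ s ∈ T, s ∉ ({x} : Finset (Fin n)) := fun s hs h =>
    hxT (Finset.mem_singleton.1 h ▸ hs)
  have h1z := h1 {z} (Finset.disjoint_singleton_right.2 hzx)
  simp only [Finset.set_biUnion_singleton, Set.mem_iUnion, exists_prop] at h1z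
  constructor
  · rintro ⟨s, hs, hsz⟩
    rcases Finset.mem_insert.1 hs with rfl | hsT
    · obtain ⟨s', hs', h'⟩ := h1z.1 hsz
      exact ⟨s', Finset.mem_union_right T hs', h'⟩
    · exact ⟨s, Finset.mem_union_left B hsT, (h2 s z (hTx s hsT) hzx).1 hsz⟩
  · rintro ⟨s, hs, hsz⟩
    rcases Finset.mem_union.1 hs with hsT | hsB
    · exact ⟨s, Finset.mem_insert_of_mem hsT, (h2 s z (hTx s hsT) hzx).2 hsz⟩
    · exact ⟨x, Finset.mem_insert_self x T, h1z.2 ⟨s, hsB, hsz⟩⟩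

/-- **Pointwise geometry of identity D.**  If `B` is exactly the set of open neighbours of `x` in `ω`
(`x ∉ T`, `b, d ≠ x`), then `d ↔ b` in `ω` with the block `insert x T` glued iff `d ↔ b` in `Ψ_B ω` with the
block `T ∪ B` glued (`stub_glueReach` on both sides, `stub_sigmaGeometry` with `O = {x}`).
[cite: KozmaNitzan2024, §3.2 p. 14] -/
theorem bystD_geo (T B : Finset (Fin n)) (x b d : Fin n) (ω : BondConfig (Fin n)) (hxT : x ∉ T)
    (hb : b ≠ x) (hd : d ≠ x)
    (hL : ∀ y : Fin n, y ∈ B ↔ (y ∉ ({x} : Finset (Fin n)) ∧ ∃ o ∈ ({x} : Finset (Fin n)), s(o, y) ∈ ω)) :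
    (ω ∪ {e | (∀ z ∈ e, z ∈ insert x T) ∧ ¬ e.IsDiag}) ∈ openConn d b ↔
      (({e | e ∈ ω ∧ ∀ y ∈ e, y ∉ ({x} : Finset (Fin n))} ∪ {e | (∀ y ∈ e, y ∈ B) ∧ ¬ e.IsDiag} :
          BondConfig (Fin n)) ∪ {e | (∀ z ∈ e, z ∈ T ∪ B) ∧ ¬ e.IsDiag}) ∈ openConn d b := by
  have hclique : ∀ o₁ ∈ ({x} : Finset (Fin n)), ∀ o₂ ∈ ({x} : Finset (Fin n)), o₁ ≠ o₂ → s(o₁, o₂) ∈ ω :=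
    fun o₁ h₁ o₂ h₂ hne => absurd ((Finset.mem_singleton.1 h₁).trans (Finset.mem_singleton.1 h₂).symm) hne
  obtain ⟨-, h2⟩ := stub_sigmaGeometry n ({x} : Finset (Fin n)) B ω hL hclique
  have hbx : b ∉ ({x} : Finset (Fin n)) := fun h => hb (Finset.mem_singleton.1 h)
  have hdx : d ∉ ({x} : Finset (Fin n)) := fun h => hd (Finset.mem_singleton.1 h)
  have hsymm : ∀ (η : BondConfig (Fin n)) (p q : Fin n), η ∈ openConn p q ↔ η ∈ openConn q p :=
    fun η p q => ⟨blockGrowth_openConn_symm, blockGrowth_openConn_symm⟩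
  rw [stub_glueReach n (insert x T) ω d b, stub_glueReach n (T ∪ B) _ d b]
  refine or_congr (h2 d b hdx hbx) (and_congr ?_ (bystD_reach_iff T B x b ω hxT hb hL))
  exact (exists_congr fun s => and_congr_right fun _ => hsymm ω d s).trans
    ((bystD_reach_iff T B x d ω hxT hd hL).trans
      (exists_congr fun s => and_congr_right fun _ => hsymm _ s d))

end BystanderDesignated

/-- **σ-identity D (bystander glued designation reliability)** — registered stub `stub_bystanderDesignated_c5` of
crux stmt-CriticalPhenomena-4576 (line `peel`): the law of total probability over the open star `B` of the bystander
`x`, `μ_{u/(insert x T)}(d ↔ b) = Σ_B μ_u(open star of x = B) · μ_{q_B/(T ∪ B)}(d ↔ b)`, both sides written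
un-glued (`μ(d ↔ b) + μ(d ↮ b, d ↔ block, block ↔ b)`), `q_B` = `u` with the star of `x` killed and `B` glued.
Merge each pair of summands into one preimage event (`bystD_split`), partition by the layer (`sigmaRec_partition`),
rewrite the event through `Ψ_B` on each layer (`bystD_geo`), factor (`stub_sigmaLaw` with `O = {x}`, `u/{x} = u`).
[cite: KozmaNitzan2024, §3.1 Remark p. 5, §3.2 pp. 13–14 (the `σ_B`-decomposition)] -/
theorem stub_bystanderDesignated_c5 :
    ∀ (n : ℕ) (u : Sym2 (Fin n) → unitInterval) (T : Finset (Fin n)) (x b d : Fin n),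
      x ∉ T → b ≠ x → d ≠ x →
      (prodBernoulli u).real (openConn d b)
          + (prodBernoulli u).real
              ((openConn d b)ᶜ ∩ (⋃ v ∈ insert x T, openConn d v) ∩ (⋃ v ∈ insert x T, openConn v b))
        = ∑ B : Finset (Fin n),
            (prodBernoulli u).real
                {ω : BondConfig (Fin n) | ∀ y : Fin n, y ∈ B ↔ (y ∉ ({x} : Finset (Fin n)) ∧
                  ∃ o ∈ ({x} : Finset (Fin n)), s(o, y) ∈ ω)}
              * ((prodBernoulli (fun e : Sym2 (Fin n) =>
                    if (∀ y ∈ e, y ∈ B) ∧ ¬ e.IsDiag then 1 else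
                      if (∃ y ∈ e, y ∈ ({x} : Finset (Fin n))) then 0 else u e)).real (openConn d b)
                + (prodBernoulli (fun e : Sym2 (Fin n) =>
                    if (∀ y ∈ e, y ∈ B) ∧ ¬ e.IsDiag then 1 else
                      if (∃ y ∈ e, y ∈ ({x} : Finset (Fin n))) then 0 else u e)).real
                    ((openConn d b)ᶜ ∩ (⋃ v ∈ T ∪ B, openConn d v) ∩ (⋃ v ∈ T ∪ B, openConn v b))) := by
  intro n u T x b d hxT hb hd
  rw [bystD_split u (insert x T) d b]
  rw [sigmaRec_partition u ({x} : Finset (Fin n))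
    {ω : BondConfig (Fin n) | (ω ∪ {e | (∀ z ∈ e, z ∈ insert x T) ∧ ¬ e.IsDiag}) ∈ openConn d b}]
  refine Finset.sum_congr rfl fun B _ => ?_
  rw [bystD_split _ (T ∪ B) d b]
  have hlaw := stub_sigmaLaw n u {x} B
    {ω' : BondConfig (Fin n) | (ω' ∪ {e | (∀ z ∈ e, z ∈ T ∪ B) ∧ ¬ e.IsDiag}) ∈ openConn d b}
  rw [peelGlue_glue_singleton u x] at hlaw
  rw [← hlaw]
  congr 1
  ext ω
  simp only [Set.mem_inter_iff, Set.mem_setOf_eq]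
  exact and_congr_right fun hL => bystD_geo T B x b d ω hxT hb hd hL

end

end Summit.CriticalPhenomena.PercolationContinuityZ3.Theorems
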